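import Literature.NumberTheory.EllipticCurves.PAdicOneVariableSeriesFamilyOfRelNormCoherentUnits
import Literature.NumberTheory.EllipticCurves.PAdicOneVariableUnitsSocketInjective
import Literature.NumberTheory.EllipticCurves.PAdicOneVariableCharacterSupport
import Literature.NumberTheory.EllipticCurves.PAdicOneVariableAffinePushforward
import HarnessLib

set_option autoImplicit false

/-!
# «THE PRIMITIVE IS LOG-FREE»: a bounded `D`-primitive of every bounded power series whose Amice distribution
# lives on `ℤ_p^×` — de Shalit I.3.3 (7′)/(8), I.3.5 (10)/(11) read backwards (`A := P_{(x⁻¹·D_H)}`), and its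
# instance for the relative norm-coherent units at `p = 2`

Cell `bsd-print-cf2`, discharge-interface typer `bsd-print-cf2-ty2` g45 (literature-prover seat; Summits-side helpers in the
typer's directory `Rank1Residual/P2/`, Theses-free, no item): port P47 of STUB-PLAN `stub_heegnerIndexLowerAtTwo` v7.3–v7.7 (crux
`PrintCf2.SplitBadTwoLowerHalfOfFacts`, stmt-BirchSwinnertonDyer-27851; CRITIC-ROWS-g40 row 115, node R218 «PRIM₂»; sketch k2-g39
`b38baf630f76efe8` §1–§5 + §6's two proved lemmas + the critic's `_one` corollary of `critic_k2g39_R218_at_one.lean`). HONEST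
FRAMING: nothing here proves BSD, the crux or the stub; it discharges ONE priced sub-node (R218) of the registered line in the
measure currency of the tree (`invAmice₁`, `BoundedDistribution.density`, `unitInv`, `mahlerD`, `affineSeries`). No named fact,
no `sorry`; ONE `Prop`-valued receptacle `BoundedPrimitive` (k3-g38's sub-stub signature, explicit binders).

THESIS. The bounded `D`-primitive needs NO logarithm and NO `2`-adic estimate: for ANY bounded `P ∈ 𝕜⟦S⟧` whose Amice
distribution `D_P` lives on `ℤ_p^×`, the Amice transform `A := P_ν` of the bounded distribution `ν := x⁻¹·D_P` satisfies
`‖[S^k]A‖ ≤ C` (same bound) and `mahlerD A = P` — because `D_{DA} = x·D_A = x·x⁻¹·D_P = D_P` levelwise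
(`density_cast_invAmice₁_μ`, `μ_succ_eq_integral_density_unitInv`, Amice inversion `invAmice₁_amice_μ` / `eq_of_invAmice₁_μ_eq`).

* §1 `BoundedPrimitive H C` (receptacle); `density_μ_succ_eq_zero_of_forall` (densities of unit-supported distributions are
  unit-supported).
* §2 ★★★ `exists_bounded_mahlerD_eq_of_forall_μ_succ_eq_zero` (generic `p`, generic complete ultrametric `ℚ_p`-field `𝕜`),
  `boundedPrimitive_of_forall_μ_succ_eq_zero`; `tsum_coeff_amice_mul_pow_eq_charSum` (the FINITE value formula
  `A(ε − 1) = Σ_{a mod pⁿ} ν(a)·ε^a` at a `pⁿ`-torsion point — what the reading node consumes).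
* §3 uniqueness of `D`-primitives (`eq_add_C_of_mahlerD_eq`) and «bounded for free» (`norm_coeff_succ_le_of_mahlerD_eq`: de Shalit's
  integrality Lemma I.3.3 (7) for `log̃` becomes a COROLLARY of the support statement (7′)).
* §4 the instance for the RELATIVE norm-coherent units at `p = 2` under EXACTLY the hypotheses of the tree's ★
  `seriesFamily_hsock_of_relNormCoherentUnits`: `exists_bounded_mahlerD_eq_relTildeSeries`, `boundedPrimitive_relNormCoherentUnits`,
  and at the SHARP constant `C = 1` with no `hC` (`boundedPrimitive_relNormCoherentUnits_one`, the critic's corollary).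
* §5 «the Frobenius-twist term dies on the units»: the distribution of `H ∘ [p]` vanishes on every unit class
  (`invAmice₁_affineSeries_zero_μ_succ_eq_zero_of_isUnit`, `invAmice₁_sub_smul_affineSeries_μ_succ_eq`).

References: [deShalit1987] I.3.1 (1)–(3) p. 16; I.3.3 (7), (7′), (8) p. 17; I.3.4 (10), I.3.5 (11) p. 18; [MazurTateTeitelbaum1986Invent]
§I.11; [Lang1990CyclotomicFields] Ch. 4 §2 Meas 7.
-/

noncomputable section

namespace Summit.BirchSwinnertonDyer.Rank1Residual.P2.LogFreePrimitive

open Literature.NumberTheory.EllipticCurves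

/-! ### §1. The receptacle; unit-supported distributions: every density `f·D` again lives on `ℤ_p^×` -/

section Generic

variable {p : ℕ} [Fact p.Prime]
variable {𝕜 : Type*} [NormedField 𝕜] [NormedAlgebra ℚ_[p] 𝕜] [IsUltrametricDist 𝕜] [CompleteSpace 𝕜]

omit [Fact p.Prime] [NormedAlgebra ℚ_[p] 𝕜] [IsUltrametricDist 𝕜] [CompleteSpace 𝕜] in
/-- **Sub-stub PRIM (k3-g38's signature, verbatim shape; a receptacle with explicit binders):** every member of the family
`H` has a `D`-primitive with the family's bound `C`. [cite: deShalit1987, I.3.3 (7′)/(8) (p. 17)] -/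
def BoundedPrimitive {B : Type*} (H : B → PowerSeries 𝕜) (C : ℝ) : Prop :=
  ∀ b, ∃ A : PowerSeries 𝕜, (∀ m, ‖PowerSeries.coeff m A‖ ≤ C) ∧ mahlerD A = H b

omit [NormedAlgebra ℚ_[p] 𝕜] in
/-- If `D` vanishes on every non-unit class (levels `≥ 1`), so does `f·D` for EVERY admissible density `f` (the integrand
`𝟙_b·f` vanishes on `ℤ_p^×`, where `D` lives). [cite: deShalit1987, I.3.3 (7′) (p. 17)] -/
theorem density_μ_succ_eq_zero_of_forall (D : BoundedDistribution (ProfiniteTower.padicInt p) 𝕜)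
    (hsupp : ∀ (n : ℕ) (b : ZMod (p ^ (n + 1))), ¬ IsUnit b → D.μ (n + 1) b = 0)
    (f : ℤ_[p] → 𝕜) (hf : UniformContinuous f) (hf1 : ∀ x, ‖f x‖ ≤ 1) (n : ℕ) (b : ZMod (p ^ (n + 1)))
    (hb : ¬ IsUnit b) :
    (D.density (ProfiniteTower.padicInt_isUniform p) f hf hf1).μ (n + 1) b = 0 := by
  rw [BoundedDistribution.density_μ]
  have hcf : UniformContinuous (BoundedDistribution.cellFun (T := ProfiniteTower.padicInt p) (n + 1) b f) :=
    BoundedDistribution.uniformContinuous_cellFun (ProfiniteTower.padicInt_isUniform p) (n + 1) b hf hf1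
  have h0 : (fun x : ℤ_[p] ↦ (if IsUnit (PadicInt.toZModPow 1 x) then (1 : 𝕜) else 0) *
      BoundedDistribution.cellFun (T := ProfiniteTower.padicInt p) (n + 1) b f x) = fun _ ↦ 0 := by
    funext x
    rw [BoundedDistribution.cellFun_apply, ProfiniteTower.padicInt_proj]
    split_ifs with h1 h2
    · exact absurd (h2 ▸ (isUnit_toZModPow_succ_iff n x).mpr ((isUnit_toZModPow_one_iff x).mp h1)) hb
    · simp
    · simp
    · simp
  have hF : UniformContinuous (fun x : ℤ_[p] ↦ (if IsUnit (PadicInt.toZModPow 1 x) then (1 : 𝕜) else 0) *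
      BoundedDistribution.cellFun (T := ProfiniteTower.padicInt p) (n + 1) b f x) := by
    rw [h0]; exact uniformContinuous_const
  rw [← D.integral_restrictUnits_eq_of_forall hsupp hcf, integral_restrictUnits D hF, h0,
    D.integral_zero_fun]

/-! ### §2. THE LOG-FREE BOUNDED PRIMITIVE (de Shalit (7′)+(10)+(11) read backwards); the finite value formula -/

/-- ★★★ **R218 «PRIM₂», generic form.** A power series `P` with `‖[S^k]P‖ ≤ C` whose distribution `D_P` is supported on
`ℤ_p^×` has a `D`-primitive with the SAME bound: `A := P_ν`, the Amice transform of the bounded distribution `ν := x⁻¹·D_P`;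
then `D_{DA} = x·D_A = x·ν = D_P` levelwise, so `DA = P` by Amice inversion. No logarithm, no `p`-adic estimate, every `p`.
[cite: deShalit1987, I.3.3 (7′)/(8) (p. 17), I.3.5 (10)/(11) (p. 18)] -/
theorem exists_bounded_mahlerD_eq_of_forall_μ_succ_eq_zero {P : PowerSeries 𝕜} {C : ℝ}
    (hC : ∀ k, ‖PowerSeries.coeff k P‖ ≤ C)
    (hsupp : ∀ (n : ℕ) (b : ZMod (p ^ (n + 1))), ¬ IsUnit b → (invAmice₁ p P hC).μ (n + 1) b = 0) :
    ∃ A : PowerSeries 𝕜, (∀ k, ‖PowerSeries.coeff k A‖ ≤ C) ∧ mahlerD A = P := by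
  -- `ν := x⁻¹ · D_P`, `A := P_ν`
  set ν := (invAmice₁ p P hC).density (ProfiniteTower.padicInt_isUniform p) (unitInv (p := p) 𝕜)
    uniformContinuous_unitInv norm_unitInv_le with hν
  have hA : ∀ k, ‖PowerSeries.coeff k ν.amice‖ ≤ C := fun k ↦ (ν.norm_coeff_amice_le k).trans_eq rfl
  refine ⟨ν.amice, hA, eq_of_invAmice₁_μ_eq (p := p) (norm_coeff_mahlerD_le hA) hC ?_⟩
  -- `D_A = ν` levelwise (Amice inversion)
  have hDA : ∀ m c, (invAmice₁ p ν.amice hA).μ m c = ν.μ m c := fun m c ↦ by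
    rw [invAmice₁_μ, ← ν.invAmice₁_amice_μ m c, invAmice₁_μ]
  -- levels `≥ 1` suffice; there `D_{DA} = x · D_A = x · ν`, which is `D_P` on unit classes and `0` off them
  refine μ_eq_of_μ_succ_eq _ _ (fun n b ↦ ?_)
  rw [← density_cast_invAmice₁_μ hA (n + 1) b, BoundedDistribution.density_μ_congr hDA]
  by_cases hb : IsUnit b
  · rw [BoundedDistribution.density_μ]
    exact (μ_succ_eq_integral_density_unitInv (invAmice₁ p P hC) n b hb).symm
  · rw [hsupp n b hb]
    exact density_μ_succ_eq_zero_of_forall ν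
      (fun m c hc ↦ density_unitInv_μ_succ_of_not_isUnit (invAmice₁ p P hC) m c hc) _
      uniformContinuous_padicIntCast' (fun x ↦ norm_padicIntCast_le_one x) n b hb

/-- `BoundedPrimitive` for ANY family of bounded series whose distributions live on `ℤ_p^×`.
[cite: deShalit1987, I.3.3 (7′)/(8) (p. 17)] -/
theorem boundedPrimitive_of_forall_μ_succ_eq_zero {B : Type*} (H : B → PowerSeries 𝕜) {C : ℝ}
    (hC : ∀ b k, ‖PowerSeries.coeff k (H b)‖ ≤ C)
    (hsupp : ∀ (b : B) (n : ℕ) (c : ZMod (p ^ (n + 1))), ¬ IsUnit c → (invAmice₁ p (H b) (hC b)).μ (n + 1) c = 0) :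
    BoundedPrimitive H C :=
  fun b ↦ exists_bounded_mahlerD_eq_of_forall_μ_succ_eq_zero (p := p) (hC b) (hsupp b)

/-- **`A(ε − 1) = Σ_{a mod pⁿ} ν(a + pⁿℤ_p)·ε^a`** for the Amice transform `A = P_ν` of a bounded distribution and `ε^{pⁿ} = 1`:
the value of the primitive at a torsion point is a FINITE character sum of level-`n` masses of `ν = x⁻¹·D_P` (no logarithm
enters the value either). [cite: deShalit1987, I.3.1 (1) (p. 16), I.3.3 (8) (p. 17)] -/
theorem tsum_coeff_amice_mul_pow_eq_charSum (ν : BoundedDistribution (ProfiniteTower.padicInt p) 𝕜) (n : ℕ)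
    {ε : 𝕜} (hε : ε ^ p ^ n = 1) :
    ∑' k : ℕ, PowerSeries.coeff k ν.amice * (ε - 1) ^ k = ν.charSum n ε := by
  rw [← charSum_invAmice₁_eq_tsum ν.norm_coeff_amice_le n hε, BoundedDistribution.charSum_def,
    BoundedDistribution.charSum_def]
  exact Finset.sum_congr rfl fun a _ ↦ by rw [ν.invAmice₁_amice_μ n a]

/-! ### §5 (generic). «The Frobenius-twist term dies on the units» -/

/-- ★ The distribution of `H ∘ [p] = H((1+S)^p − 1)` (tree currency: `affineSeries 0 p H = (1+S)^0 · binomDilate p H`) is the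
push-forward `(p·)_* D_H` (`affinePush_invAmice₁_μ`), hence vanishes on every UNIT class of level `≥ 1`
(`affinePush_μ_succ_eq_zero` at `a = 0`): in `H_β = H₁ − u·(H₂ ∘ [2])` the second term is invisible on `ℤ₂^×`
("`μ̃_β = μ_β|ℤ_p^×`", de Shalit I.3.3 after (7′)). [cite: deShalit1987, I.3.3 (7′) (p. 17)] -/
theorem invAmice₁_affineSeries_zero_μ_succ_eq_zero_of_isUnit {H : PowerSeries 𝕜} {C : ℝ}
    (hC : ∀ k, ‖PowerSeries.coeff k H‖ ≤ C) (n : ℕ) (c : ZMod (p ^ (n + 1))) (hc : IsUnit c) :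
    (invAmice₁ p (affineSeries 0 (p : ℤ_[p]) H) (norm_coeff_affineSeries_le hC 0 p)).μ (n + 1) c = 0 := by
  have hp : p.Prime := Fact.out
  haveI : Fact (1 < p ^ 1) := ⟨by rw [pow_one]; exact hp.one_lt⟩
  rw [← affinePush_invAmice₁_μ hC 0 (p : ℤ_[p]) (n + 1) c]
  refine (invAmice₁ p H hC).affinePush_μ_succ_eq_zero 0 n c ?_
  rw [map_zero]
  exact (hc.map _).ne_zero

/-- … with a unit scalar and an additive main term: on unit classes `D_{H₁ − u·(H₂∘[p])} = D_{H₁}`.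
[cite: deShalit1987, I.3.3 (7′) (p. 17)] -/
theorem invAmice₁_sub_smul_affineSeries_μ_succ_eq {H₁ H₂ : PowerSeries 𝕜} {C : ℝ} (u : 𝕜)
    (hC₁ : ∀ k, ‖PowerSeries.coeff k H₁‖ ≤ C) (hC₂ : ∀ k, ‖PowerSeries.coeff k H₂‖ ≤ C)
    {C' : ℝ} (hC' : ∀ k, ‖PowerSeries.coeff k (H₁ + (-u) • affineSeries 0 (p : ℤ_[p]) H₂)‖ ≤ C')
    {C'' : ℝ} (hC'' : ∀ k, ‖PowerSeries.coeff k ((-u) • affineSeries 0 (p : ℤ_[p]) H₂)‖ ≤ C'')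
    (n : ℕ) (c : ZMod (p ^ (n + 1))) (hc : IsUnit c) :
    (invAmice₁ p (H₁ + (-u) • affineSeries 0 (p : ℤ_[p]) H₂) hC').μ (n + 1) c = (invAmice₁ p H₁ hC₁).μ (n + 1) c := by
  rw [invAmice₁_add_μ hC₁ hC'' hC' (n + 1) c,
    invAmice₁_smul_μ (norm_coeff_affineSeries_le hC₂ 0 p) (-u) hC'' (n + 1) c,
    invAmice₁_affineSeries_zero_μ_succ_eq_zero_of_isUnit hC₂ n c hc, mul_zero, add_zero]

end Generic

/-! ### §3. Uniqueness of `D`-primitives: the log-currency witness is `A + const`, hence bounded for free -/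

section Uniqueness

variable {R : Type*} [CommRing R] [IsDomain R] [CharZero R]

omit [IsDomain R] [CharZero R] in
/-- `D` is additive: `D(P − Q) = DP − DQ`. -/
theorem mahlerD_sub (P Q : PowerSeries R) : mahlerD (P - Q) = mahlerD P - mahlerD Q := by
  simp only [mahlerD, map_sub, mul_sub]

/-- `DQ = 0` forces `Q` to be constant (characteristic `0`): `[S^m]DQ = (m+1)q_{m+1} + m q_m`. -/
theorem eq_C_of_mahlerD_eq_zero {Q : PowerSeries R} (h : mahlerD Q = 0) :
    Q = PowerSeries.C (PowerSeries.constantCoeff Q) := by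
  have key : ∀ m, PowerSeries.coeff (m + 1) Q = 0 := by
    intro m
    induction m with
    | zero =>
      have h0 := congrArg (PowerSeries.coeff 0) h
      simp only [coeff_mahlerD, map_zero, Nat.cast_zero, zero_add, one_mul, zero_mul, add_zero] at h0
      simpa using h0
    | succ m ih =>
      have h1 := congrArg (PowerSeries.coeff (m + 1)) h
      rw [coeff_mahlerD, map_zero, ih, mul_zero, add_zero] at h1
      have hne : ((m + 1 : ℕ) : R) + 1 ≠ 0 := by exact_mod_cast Nat.succ_ne_zero (m + 1)
      exact (mul_eq_zero.mp h1).resolve_left hne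
  ext n
  cases n with
  | zero => simp
  | succ m => rw [key m, PowerSeries.coeff_C, if_neg (Nat.succ_ne_zero m)]

/-- ★ **Two `D`-primitives of the same series differ by a constant.** -/
theorem eq_add_C_of_mahlerD_eq {A A' : PowerSeries R} (h : mahlerD A = mahlerD A') :
    A = A' + PowerSeries.C (PowerSeries.constantCoeff (A - A')) := by
  have h0 : mahlerD (A - A') = 0 := by rw [mahlerD_sub, h, sub_self]
  rw [← eq_C_of_mahlerD_eq_zero h0]
  ring

/-- ★ **Bounded for free.** If `L` is ANY `D`-primitive of `DA` with `A` bounded by `C` (e.g. the formal log-currency witness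
`Ω⁻¹Θ(log̃_E g_b∘ϑ)` against the measure-side `A_b` of §2), then every coefficient of `L` of positive degree is bounded by `C` — de
Shalit's integrality Lemma I.3.3 (7) for `log̃` becomes a COROLLARY of the support statement (7′). [cite: deShalit1987, I.3.3 (7) (p. 17)] -/
theorem norm_coeff_succ_le_of_mahlerD_eq {𝕜 : Type*} [NormedField 𝕜] [CharZero 𝕜] {A L : PowerSeries 𝕜}
    {C : ℝ} (hA : ∀ k, ‖PowerSeries.coeff k A‖ ≤ C) (h : mahlerD L = mahlerD A) (k : ℕ) :
    ‖PowerSeries.coeff (k + 1) L‖ ≤ C := by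
  rw [eq_add_C_of_mahlerD_eq h, map_add, PowerSeries.coeff_C, if_neg (Nat.succ_ne_zero k), add_zero]
  exact hA _

end Uniqueness

/-! ### §4. INSTANTIATION: `BoundedPrimitive` for the RELATIVE norm-coherent units at `p = 2`
(the hypotheses are VERBATIM those of ★ `seriesFamily_hsock_of_relNormCoherentUnits`) -/

section RelNormCoherentUnits

open MvPowerSeries
open ValuativeRel IsLocalRing Field
open Literature.NumberTheory.GaloisRepresentations Literature.NumberTheory.GaloisRepresentations.IsNonarchimedeanLocalField
  Literature.NumberTheory.GaloisRepresentations.LubinTate Literature.NumberTheory.PAdicHodge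

variable {F : Type} [Field F] [ValuativeRel F] [TopologicalSpace F] [IsNonarchimedeanLocalField F]

attribute [local instance] ltNormUniformSpace ltNormIsUniformAddGroup rk1 nF nE fintypeResidueField

variable (h2 : (valuation F).IsUniformizer (((2 : ℕ) : 𝒪[F]) : F)) (u : 𝒪[F]ˣ)
variable (E : IntermediateField F (AlgebraicClosure F)) [FiniteDimensional F E] [Normal F E] [IsGalois F E]
  (hq : residueFieldCard F = 2) (hE : E ≤ maxUnramified F) {σ₀ : absoluteGaloisGroup F} (hσ₀ : IsAbsArithFrob σ₀)
  (j : unitBall E →+* UnrCoeff F)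
variable {ε : (maxUnramifiedCompletion F)ˣ}
  (hε : maxUnramifiedCompletion.galAut F σ₀ (ε : maxUnramifiedCompletion F) =
    algebraMap 𝒪[F] (maxUnramifiedCompletion F) (u : 𝒪[F]) * (ε : maxUnramifiedCompletion F))
variable (θ : CompletedAlgClosure F →+* ℂ_[2]) (hθc : Continuous θ)
  (hθ1 : ∀ z : CBall F, ‖θ (z : CompletedAlgClosure F)‖ ≤ 1)
  (hθζ : ∀ ζ' : ℂ_[2], (∃ n : ℕ, ζ' ^ 2 ^ n = 1) →
    ∃ ζ : CompletedAlgClosure F, (∃ n : ℕ, ζ ^ 2 ^ n = 1) ∧ θ ζ = ζ')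
  (hjC : (algebraMap (UnrCoeff F) (CBall F)).comp j = unitBallToCBall E)

include hq hθc hθ1 hθζ hjC in
/-- ★★★ **R218 «PRIM₂» DISCHARGED (log-free)**: the relative tilde series `H_β = Θ(j((δ_E g_β)~)∘ϑ)` of every relative
norm-coherent unit `β` (base `E ⊆ F^{nr}` finite Galois, `q = 2`, `π = u·2`) has a `D`-primitive in `ℂ₂⟦S⟧` with the same coefficient
bound — from the tree's support theorem (7′) (`invAmice₁_μ_eq_zero_of_relTraceTwo_eq_zero` ∘ `relTraceTwo_relTildeSeries`) and §2.
[cite: deShalit1987, I.3.3 (7′)/(8) (p. 17), I.3.5 (10)/(11) (p. 18)] -/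
theorem exists_bounded_mahlerD_eq_relTildeSeries (β : RelNormCoherentUnits (isUniformizer_unit_mul h2 u) E) {C : ℝ}
    (hC : ∀ k : ℕ, ‖PowerSeries.coeff k ((PowerSeries.subst (compSeriesC h2 hσ₀ u hε)
      ((relTildeSeries (isUniformizer_unit_mul h2 u) E hq hE hσ₀ (LTCoeff.of F (u : 𝒪[F])) β).map j)).map
      (θ.comp ((CBall F).subtype.comp (algebraMap (UnrCoeff F) (CBall F)))))‖ ≤ C) :
    ∃ A : PowerSeries ℂ_[2], (∀ k, ‖PowerSeries.coeff k A‖ ≤ C) ∧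
      mahlerD A = (PowerSeries.subst (compSeriesC h2 hσ₀ u hε)
        ((relTildeSeries (isUniformizer_unit_mul h2 u) E hq hE hσ₀ (LTCoeff.of F (u : 𝒪[F])) β).map j)).map
        (θ.comp ((CBall F).subtype.comp (algebraMap (UnrCoeff F) (CBall F)))) := by
  refine exists_bounded_mahlerD_eq_of_forall_μ_succ_eq_zero (p := 2) hC (fun N b hb ↦ ?_)
  have hbridge := map_subst_compSeriesC_map_eq h2 u E hσ₀ j hε θ hjC
    (relTildeSeries (isUniformizer_unit_mul h2 u) E hq hE hσ₀ (LTCoeff.of F (u : 𝒪[F])) β)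
  rw [invAmice₁_μ_congr (p := 2) hbridge hC (norm_coeff_map_le_one θ hθ1 _)]
  exact invAmice₁_μ_eq_zero_of_relTraceTwo_eq_zero hq h2 hσ₀ u hε θ hθc hθ1 hθζ E _
    (relTraceTwo_relTildeSeries (isUniformizer_unit_mul h2 u) E hq hE hσ₀ (of_unit_mul_two_eq hq u) β) N b hb

include hq hθc hθ1 hθζ hjC in
/-- ★★★ The same in the `BoundedPrimitive` shape for the FAMILY `b ↦ H_{η b}` of `PAdicOneVariableSeriesFamilyOfRelNormCoherentUnits`
(any index type `B`, any `η`, one uniform bound `C`, as in the series-family files' `hC`). [cite: deShalit1987, I.3.3 (7′)/(8) (p. 17)] -/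
theorem boundedPrimitive_relNormCoherentUnits {B : Type*} (η : B → RelNormCoherentUnits (isUniformizer_unit_mul h2 u) E)
    {C : ℝ}
    (hC : ∀ (b : B) (k : ℕ), ‖PowerSeries.coeff k ((PowerSeries.subst (compSeriesC h2 hσ₀ u hε)
      ((relTildeSeries (isUniformizer_unit_mul h2 u) E hq hE hσ₀ (LTCoeff.of F (u : 𝒪[F])) (η b)).map j)).map
      (θ.comp ((CBall F).subtype.comp (algebraMap (UnrCoeff F) (CBall F)))))‖ ≤ C) :
    BoundedPrimitive (fun b ↦ (PowerSeries.subst (compSeriesC h2 hσ₀ u hε)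
      ((relTildeSeries (isUniformizer_unit_mul h2 u) E hq hE hσ₀ (LTCoeff.of F (u : 𝒪[F])) (η b)).map j)).map
      (θ.comp ((CBall F).subtype.comp (algebraMap (UnrCoeff F) (CBall F))))) C :=
  fun b ↦ exists_bounded_mahlerD_eq_relTildeSeries h2 u E hq hE hσ₀ j hε θ hθc hθ1 hθζ hjC (η b) (hC b)

include hq hθc hθ1 hθζ hjC in
/-- ★★★ **R218 «PRIM₂» CLOSED at the SHARP constant `C = 1`, hypothesis-free beyond the tree's socket hypotheses** (the critic's
corollary): the Θ-currency bound `1` of the family of record is the tree's (`map_subst_compSeriesC_map_eq` + `norm_coeff_map_le_one`), so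
`BoundedPrimitive (b ↦ H_{η b}) 1` holds for the VERBATIM family under EXACTLY `hq hθc hθ1 hθζ hjC`. [cite: deShalit1987, I.3.3 (7′)/(8) (p. 17)] -/
theorem boundedPrimitive_relNormCoherentUnits_one {B : Type*}
    (η : B → RelNormCoherentUnits (isUniformizer_unit_mul h2 u) E) :
    BoundedPrimitive (fun b ↦ (PowerSeries.subst (compSeriesC h2 hσ₀ u hε)
      ((relTildeSeries (isUniformizer_unit_mul h2 u) E hq hE hσ₀ (LTCoeff.of F (u : 𝒪[F])) (η b)).map j)).map
      (θ.comp ((CBall F).subtype.comp (algebraMap (UnrCoeff F) (CBall F))))) 1 :=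
  boundedPrimitive_relNormCoherentUnits h2 u E hq hE hσ₀ j hε θ hθc hθ1 hθζ hjC η (fun b k ↦ by
    rw [map_subst_compSeriesC_map_eq h2 u E hσ₀ j hε θ hjC]
    exact norm_coeff_map_le_one θ hθ1 _ k)

end RelNormCoherentUnits

end Summit.BirchSwinnertonDyer.Rank1Residual.P2.LogFreePrimitive

end
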